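import Summits.AtomisticToContinuum.Crystallization.Theses.ExcessDecayLiouville
import Literature.Barriers.AtomisticToContinuum.LocalizedPotentialsExcludeLennardJones

/-!
# Disproof of `HcpLiouville` (stmt-AtomisticToContinuum-9332) — standing adversary work file

Crux (route `ExcessDecayLiouville`, rank 3): `HcpLiouville ↔ (PS → Core)` (`hcpLiouville_iff`), where
`PS` is the inline harmonic-stability hypothesis (literally `PhononStability`, `ps_iff`) and `Core` says:
every `δ`-separated Lennard-Jones equilibrium `X ⊂ ℝ³` that is GLOBALLY two-way `1/40`-matched with an
admissible affine hcp two-lattice `Sites t A` (`Adm A`, hcp-like inner displacement `Inner t A`) is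
exactly `Sites t' A'` for some admissible `A'`.

## Findings (cycle 1, 2026-08-16)

* ELABORATION / FAITHFULNESS: rc 0; geometry checked against `BarlowStacking` (`u=(1,0,0)`,
  `v=(1/2,√3/2,0)`, `w=(1/2,√3/6,0)`, `layerNormal h = (0,0,h)`): `Λ = ℤu+ℤv+ℤ·2√(2/3)e₃`, motif
  `{0, w+√(2/3)e₃}` (unit nearest-neighbour distance) — the genuine hcp two-lattice; `lennardJones r =
  r⁻¹²/12 − r⁻⁶/6`, so `deriv lennardJones (dist p q) / dist p q • (p − q)` is `+∇_p V`, `Equil` = force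
  balance; `Hess` is the standard pair force-constant form. No junk found: all `tsum`s in `PS` are over
  absolutely summable families (`r⁻⁸` tails in `ℤ³`), `HasSum … 0` is a genuine (non-junk) proposition,
  `Adm A ⇒ A` invertible (`‖A − 0.97R‖ ≤ 1/40 < 0.97`).
* LOAD-BEARING HYPOTHESES (section `LoadBearing`): `core_false_without_Near` (X = ∅),
  `core_false_without_Adm` (A = 0, X = {0}) and `core_false_without_Equil` (hcp ∪ one extra particle at
  distance 1/40 from a site) are PROVED below: any proof must use the global matching, the admissibility
  of the reference cell and the force balance. LANDED (importable, `let`-form statements = the crux text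
  with one hypothesis deleted): `Theorems/HcpLiouville/Negative/LoadBearing.lean` (p74283:
  `hcpLiouvilleCore_false_without_matching`, `hcpLiouvilleCore_false_without_adm`) and
  `Theorems/HcpLiouville/Negative/EquilLoadBearing.lean` (p74290: `hcpLiouvilleCore_false_without_equil`,
  helpers `hcpLiouvilleLam_apply/_norm_sq/_one_le_norm/_sub_mem/_add_mem`, `hcpLiouvilleAdm_norm_le`,
  `hcpLiouvilleSites_eq_hcpStacking`). Infrastructure proved on the way (useful to provers):
  `sites_eq_hcpStacking` (the crux's `Sites` for `A = a·id` IS `hcpStacking a (a√(2/3))`),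
  `one_le_norm_of_mem_Lam` (`Λ ∖ 0` has norm ≥ 1), `adm_norm_le` (`‖A v‖ ≥ 0.945‖v‖`). `Sep X δ` is NOT load-bearing: it is implied (with δ = 87/100)
  by `Equil` + global matching + `Adm` + `Inner` (`sep_of_equil_of_near`, near-miss with paper proof in
  its docstring: clustered particles around one site cannot be in equilibrium — exposed-vertex repulsion
  ≥ 4·10¹⁶ per extra cluster member against inter-cluster forces ≤ 10² · cluster size). `PS` cannot be
  shown load-bearing by a refuter: if `PS` holds (all numerics say so) then `Core`-without-`PS` is `Core`.
* STRUCTURE (information for provers): global two-way matching at tolerance 1/40 < (site spacing)/2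
  forces (i) a BIJECTION particles ↔ sites moving each by ≤ 1/40 (given equilibrium, by the cluster
  argument), and (ii) in the conclusion necessarily `A'Λ = AΛ` and `t' ≡ t` up to 1/40 and relabelling
  (`same_cell`, paper proof in docstring). So `Core` ⟺ "hcp-type two-lattices are ISOLATED, in sup-norm
  radius 1/40 modulo sublattice translations, among all Lennard-Jones equilibria".
* KILL ATTEMPTS THAT FAILED (why it resists):
  (a) clustering / multiplicity (the `OneGrainWindow` kill pattern): excluded by equilibrium, see above;
  (b) symmetry-protected superstructures: if every site-symmetry group of a displaced structure fixes no
      vector and the structure is within 1/40 of a two-lattice, the structure is a two-lattice (paper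
      argument: such isometries preserve `AΛ`; parameter-free Wyckoff sets of supergroups are ≥ a/12 ≈
      0.08 from hcp sites or coincide); continuous symmetric families through hcp would be zero modes,
      contradicting `PS`;
  (c) anharmonic isolated equilibria: every nearest-neighbour PARTICLE distance allowed by the hypotheses
      lies in [0.87, 1.07] ⊂ (0, (13/7)^{1/6} = 1.1087) where V″ > 0 (V″(1.07) = 0.97): the 1-D
      mechanisms for period doubling (V′(a−2η) = V′(a+2η)) need a bond beyond the inflection point, i.e.
      amplitude ≥ 0.07 at a = 0.97 — outside 1/40;
  (d) known competing LJ equilibria: bcc (Burgers shuffle ≈ 0.13), stacking variants (≥ 0.28 per layer,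
      two-way 0.56), Burgers-path saddle ≈ 0.08: all outside 1/40 (route file, CHEAPEST FALSIFIER (c));
  (e) formal loopholes: X = ∅ (caught by Near), X finite (caught by Near), δ large (vacuous), A singular
      (caught by Adm), coincident cosets in the conclusion (allowed but harmless).
* NUMERICS (section `Numerics` at the end; kit job j008362 done, j013923/j013934/j013935/j013939/j013940
  queued): (i) `PS` holds numerically on all 37 sampled window configurations (cell corners ± inner-shift
  corners), κ ∈ [0.199, 0.702] in the statement's own normalisation (min at xz-shear + inner shift −z;
  relaxed cell 0.456; tension corner 0.249–0.309) — so the crux is NOT vacuous and its hypothesis is not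
  the weak point; (ii) NO non-two-lattice periodic LJ critical point within sup-distance 1/40 of an affine
  hcp two-lattice was found; the NEAREST ones sit at sup-distance η* = 0.098 (index-1 saddle, 2×2×1 cell,
  ΔE = +0.034/atom, 0.93-separated), 0.105 (index 2, layer-pair pattern, 1×1×2), 0.119 (a genuine competing
  periodic local MINIMUM, bcc-like via the Burgers path, ΔE = +0.033/atom), 0.107 at the tension corner: the
  tolerance 1/40 has a numerical safety factor ≈ 4, not ≈ 10; a restatement at tolerance ≥ 0.1 would be
  FALSE (up to the `Inner` bookkeeping, see `Numerics`).

Prose lives in docstrings; every `theorem` without `sorry` is checked. `sorry` appears only on labelled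
near-misses (permitted in this work file only).
-/

noncomputable section

namespace Summit.AtomisticToContinuum.Crystallization.Cruxes.HcpLiouville.Disproof

open Literature.MathematicalPhysics.StatisticalMechanics

/-- `ℝ³`. -/
abbrev E3 := EuclideanSpace ℝ (Fin 3)

/-- The hexagonal period lattice `Λ = ℤu + ℤv + ℤ·2√(2/3)e₃` of the unit hcp stacking (the crux's `Λ`). -/
def Lam : Set E3 :=
  {z | ∃ i j k : ℤ, z = (i : ℝ) • triangularVec₁ 1 + (j : ℝ) • triangularVec₂ 1 +
    (k : ℝ) • layerNormal (2 * Real.sqrt (2 / 3))}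

/-- Two-way `ε`-matching of `X` with the affine two-lattice `t m + A Λ` on the ball `B_r(c)` (the crux's `Near`). -/
def Near (X : Set E3) (c : E3) (r : ℝ) (t : Fin 2 → E3) (A : E3 →L[ℝ] E3) (ε : ℝ) : Prop :=
  (∀ p ∈ X, dist p c ≤ r → ∃ m : Fin 2, ∃ z ∈ Lam, dist p (t m + A z) ≤ ε) ∧
  (∀ m : Fin 2, ∀ z ∈ Lam, dist (t m + A z) c ≤ r → ∃ p ∈ X, dist p (t m + A z) ≤ ε)

/-- Admissible cell: within `1/40` (operator norm) of `0.97 · O(3)` (the crux's `Adm`). -/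
def Adm (A : E3 →L[ℝ] E3) : Prop :=
  ∃ R : E3 ≃ₗᵢ[ℝ] E3, ‖A - (97 / 100 : ℝ) • (R.toContinuousLinearEquiv : E3 →L[ℝ] E3)‖ ≤ 1 / 40

/-- hcp-like inner displacement (the crux's `Inner`). -/
def Inner (t : Fin 2 → E3) (A : E3 →L[ℝ] E3) : Prop :=
  ‖t 1 - t 0 - A (barlowOffset 1 + layerNormal (Real.sqrt (2 / 3)))‖ ≤ 1 / 40

/-- The site set of the affine two-lattice (the crux's `Sites`). -/
def Sites (t : Fin 2 → E3) (A : E3 →L[ℝ] E3) : Set E3 :=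
  {p | ∃ m : Fin 2, ∃ z ∈ Lam, p = t m + A z}

/-- Pair force-constant quadratic form `wᵀ K(e) w` (the crux's `Hess`). -/
def Hess (e w : E3) : ℝ :=
  deriv (deriv lennardJones) ‖e‖ * (inner ℝ e w / ‖e‖) ^ 2 +
    deriv lennardJones ‖e‖ / ‖e‖ * (‖w‖ ^ 2 - (inner ℝ e w / ‖e‖) ^ 2)

/-- `δ`-separation (the crux's `Sep`). -/
def Sep (X : Set E3) (δ : ℝ) : Prop := ∀ p ∈ X, ∀ q ∈ X, p ≠ q → δ ≤ dist p q

/-- Lennard-Jones force balance at every point (the crux's `Equil`). -/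
def Equil (X : Set E3) : Prop :=
  ∀ p ∈ X, HasSum (fun q : {q : E3 // q ∈ X ∧ q ≠ p} =>
    (deriv lennardJones (dist p q.1) / dist p q.1) • (p - q.1)) 0

/-- The inline harmonic-stability hypothesis (literally `PhononStability`, see `ps_iff`). -/
def PS : Prop :=
  ∃ κ : ℝ, 0 < κ ∧ ∀ (t : Fin 2 → E3) (A : E3 →L[ℝ] E3), Adm A → Inner t A →
    ∀ u : E3 → E3, (Function.support u).Finite → Function.support u ⊆ Sites t A →
      κ * (∑' p : Sites t A, ∑' q : Sites t A,
        if dist (p : E3) q ≤ 11 / 10 then ‖u p - u q‖ ^ 2 else 0) ≤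
      (∑' p : Sites t A, ∑' q : Sites t A,
        if (p : E3) ≠ q then Hess ((p : E3) - q) (u p - u q) else 0) / 2

/-- The unconditional content of the crux: the coarse Liouville statement itself. -/
def Core : Prop :=
  ∀ δ : ℝ, 0 < δ → ∀ X : Set E3, Sep X δ → Equil X →
    ∀ (t : Fin 2 → E3) (A : E3 →L[ℝ] E3), Adm A → Inner t A →
      (∀ (c : E3) (r : ℝ), Near X c r t A (1 / 40)) →
        ∃ (t' : Fin 2 → E3) (A' : E3 →L[ℝ] E3), Adm A' ∧ X = Sites t' A'

/-- The crux is, by definitional unfolding of its `let`s, `PS → Core`. [folklore] -/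
theorem hcpLiouville_iff :
    Summit.AtomisticToContinuum.Crystallization.Theses.ExcessDecayLiouville.HcpLiouville ↔ (PS → Core) :=
  Iff.rfl

/-- The inline hypothesis is literally the route's crux `PhononStability` (stmt-9333). [folklore] -/
theorem ps_iff :
    PS ↔ Summit.AtomisticToContinuum.Crystallization.Theses.ExcessDecayLiouville.PhononStability :=
  Iff.rfl

/-! ## Load-bearing analysis -/
section LoadBearing

/-- `0 ∈ Λ`. [folklore] -/
theorem zero_mem_Lam : (0 : E3) ∈ Lam := ⟨0, 0, 0, by simp⟩

/-- The `c`-vector `2√(2/3) e₃ ∈ Λ`. [folklore] -/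
theorem layerNormal_mem_Lam : layerNormal (2 * Real.sqrt (2 / 3)) ∈ Lam := ⟨0, 0, 1, by simp⟩

/-- The `c`-vector is nonzero. [folklore] -/
theorem layerNormal_ne_zero : (layerNormal (2 * Real.sqrt (2 / 3)) : E3) ≠ 0 := by
  intro hz
  have h2 := congrArg (fun v : E3 => v 2) hz
  simp [layerNormal] at h2

/-- Coordinates of a vector of `Λ`. [folklore] -/
theorem lam_apply (i j k : ℤ) :
    let z : E3 := (i : ℝ) • triangularVec₁ 1 + (j : ℝ) • triangularVec₂ 1 +
      (k : ℝ) • layerNormal (2 * Real.sqrt (2 / 3))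
    z 0 = i + j * 2⁻¹ ∧ z 1 = j * (√3 / 2) ∧ z 2 = k * (2 * Real.sqrt (2 / 3)) := by
  refine ⟨?_, ?_, ?_⟩ <;> simp [triangularVec₁, triangularVec₂, layerNormal]

/-- `|i u + j v + k c|² = i² + ij + j² + (8/3) k²`. [folklore] -/
theorem norm_sq_lam (i j k : ℤ) :
    ‖(i : ℝ) • triangularVec₁ 1 + (j : ℝ) • triangularVec₂ 1 +
      (k : ℝ) • (layerNormal (2 * Real.sqrt (2 / 3)) : E3)‖ ^ 2
      = ((i : ℝ) ^ 2 + i * j + j ^ 2) + 8 / 3 * (k : ℝ) ^ 2 := by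
  obtain ⟨h0, h1, h2⟩ := lam_apply i j k
  rw [EuclideanSpace.norm_sq_eq, Fin.sum_univ_three]
  simp only [Real.norm_eq_abs, sq_abs]
  rw [h0, h1, h2]
  have h3 : (√3 : ℝ) ^ 2 = 3 := Real.sq_sqrt (by norm_num)
  have h23 : (Real.sqrt (2 / 3)) ^ 2 = 2 / 3 := Real.sq_sqrt (by norm_num)
  linear_combination ((j : ℝ) ^ 2 / 4) * h3 + (4 * (k : ℝ) ^ 2) * h23

/-- **`Λ` is uniformly discrete**: nonzero vectors of `Λ` have norm `≥ 1` (so admissible images `A Λ` are `0.945`-discrete, `adm_norm_le`). [folklore] -/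
theorem one_le_norm_of_mem_Lam {z : E3} (hz : z ∈ Lam) (h0 : z ≠ 0) : 1 ≤ ‖z‖ := by
  obtain ⟨i, j, k, rfl⟩ := hz
  have hsq := norm_sq_lam i j k
  have h1 : (1 : ℝ) ≤ ((i : ℝ) ^ 2 + i * j + j ^ 2) + 8 / 3 * (k : ℝ) ^ 2 := by
    by_cases hk : k = 0
    · subst hk
      have hij : (i, j) ≠ 0 := by
        rintro hij
        simp only [Prod.mk_eq_zero] at hij
        obtain ⟨rfl, rfl⟩ := hij
        exact h0 (by simp)
      have := one_le_sq_add_mul_add_sq hij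
      have : (1 : ℝ) ≤ (i : ℝ) ^ 2 + i * j + j ^ 2 := by exact_mod_cast this
      simp; linarith
    · have hk1 : (1 : ℝ) ≤ (k : ℝ) ^ 2 := by
        have : 1 ≤ k ^ 2 := by nlinarith [Int.one_le_abs hk, sq_abs k]
        exact_mod_cast this
      nlinarith [sq_nonneg ((i : ℝ) + j / 2), sq_nonneg (j : ℝ)]
  have : (1 : ℝ) ≤ ‖_‖ ^ 2 := hsq ▸ h1
  nlinarith [norm_nonneg ((i : ℝ) • triangularVec₁ 1 + (j : ℝ) • triangularVec₂ 1 +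
      (k : ℝ) • (layerNormal (2 * Real.sqrt (2 / 3)) : E3))]

/-- **The crux's `Sites` for the isotropic cell `a · id` and exact hcp translations `t = (0, a(w + √(2/3)e₃))` is the
library's `hcpStacking a (a√(2/3))`** (so all of `BarlowStacking`'s distance / layer / periodicity lemmas apply to the
reference two-lattices of the crux). [cite: HalesDSP2012, §1.3] -/
theorem sites_eq_hcpStacking (a : ℝ) :
    {p : E3 | ∃ m : Fin 2, ∃ z ∈ Lam,
      p = (![0, a • (barlowOffset 1 + layerNormal (Real.sqrt (2 / 3)))] : Fin 2 → E3) m +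
        (a • ContinuousLinearMap.id ℝ E3) z}
      = hcpStacking a (a * Real.sqrt (2 / 3)) := by
  ext p
  constructor
  · rintro ⟨m, z, ⟨i, j, k, rfl⟩, rfl⟩
    fin_cases m
    · refine ⟨2 * k, i, j, ?_⟩
      have hE : haggLabel alternatingHagg (2 * k) = 0 := by
        rw [haggLabel_alternating, if_pos (even_two_mul k)]
      ext l; fin_cases l <;>
        simp [barlowPos, triangularVec₁, triangularVec₂, barlowOffset, layerNormal, hE] <;> ring
    · refine ⟨2 * k + 1, i, j, ?_⟩
      have hO : haggLabel alternatingHagg (2 * k + 1) = 1 := by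
        rw [haggLabel_alternating, if_neg (Int.not_even_two_mul_add_one k)]
      ext l; fin_cases l <;>
        simp [barlowPos, triangularVec₁, triangularVec₂, barlowOffset, layerNormal, hO] <;> ring
  · rintro ⟨K, i, j, rfl⟩
    rcases Int.even_or_odd' K with ⟨k, rfl | rfl⟩
    · refine ⟨0, _, ⟨i, j, k, rfl⟩, ?_⟩
      have hE : haggLabel alternatingHagg (2 * k) = 0 := by
        rw [haggLabel_alternating, if_pos (even_two_mul k)]
      ext l; fin_cases l <;>
        simp [barlowPos, triangularVec₁, triangularVec₂, barlowOffset, layerNormal, hE] <;> ring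
    · refine ⟨1, _, ⟨i, j, k, rfl⟩, ?_⟩
      have hO : haggLabel alternatingHagg (2 * k + 1) = 1 := by
        rw [haggLabel_alternating, if_neg (Int.not_even_two_mul_add_one k)]
      ext l; fin_cases l <;>
        simp [barlowPos, triangularVec₁, triangularVec₂, barlowOffset, layerNormal, hO] <;> ring

/-- `Λ` is closed under subtraction. [folklore] -/
theorem sub_mem_Lam {x y : E3} (hx : x ∈ Lam) (hy : y ∈ Lam) : x - y ∈ Lam := by
  obtain ⟨i, j, k, rfl⟩ := hx
  obtain ⟨i', j', k', rfl⟩ := hy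
  refine ⟨i - i', j - j', k - k', ?_⟩
  push_cast
  module
/-- `Λ` is closed under addition. [folklore] -/
theorem add_mem_Lam {x y : E3} (hx : x ∈ Lam) (hy : y ∈ Lam) : x + y ∈ Lam := by
  obtain ⟨i, j, k, rfl⟩ := hx
  obtain ⟨i', j', k', rfl⟩ := hy
  refine ⟨i + i', j + j', k + k', ?_⟩
  push_cast
  module

/-- **Admissible cells are uniformly injective**: `‖A v‖ ≥ (0.97 − 1/40)‖v‖ = 0.945‖v‖`. [folklore] -/
theorem adm_norm_le {A : E3 →L[ℝ] E3} (hA : Adm A) (v : E3) : (189 / 200) * ‖v‖ ≤ ‖A v‖ := by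
  obtain ⟨R, hR⟩ := hA
  have h1 : ‖(A - (97 / 100 : ℝ) • (R.toContinuousLinearEquiv : E3 →L[ℝ] E3)) v‖ ≤ 1 / 40 * ‖v‖ :=
    (ContinuousLinearMap.le_opNorm _ _).trans (mul_le_mul_of_nonneg_right hR (norm_nonneg _))
  have h2 : ‖((97 / 100 : ℝ) • (R.toContinuousLinearEquiv : E3 →L[ℝ] E3)) v‖ = 97 / 100 * ‖v‖ := by
    simp [norm_smul]
  have h3 := norm_sub_norm_le (((97 / 100 : ℝ) • (R.toContinuousLinearEquiv : E3 →L[ℝ] E3)) v) (A v)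
  rw [h2, norm_sub_rev] at h3
  have h4 : ‖A v - ((97 / 100 : ℝ) • (R.toContinuousLinearEquiv : E3 →L[ℝ] E3)) v‖ =
      ‖(A - (97 / 100 : ℝ) • (R.toContinuousLinearEquiv : E3 →L[ℝ] E3)) v‖ := by
    simp only [sub_apply]
  linarith [h4 ▸ h3]

/-- `Core` with the global two-way matching hypothesis `∀ c r, Near X c r t A (1/40)` dropped. -/
def CoreWithoutNear : Prop :=
  ∀ δ : ℝ, 0 < δ → ∀ X : Set E3, Sep X δ → Equil X →
    ∀ (t : Fin 2 → E3) (A : E3 →L[ℝ] E3), Adm A → Inner t A →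
      ∃ (t' : Fin 2 → E3) (A' : E3 →L[ℝ] E3), Adm A' ∧ X = Sites t' A'

/-- **`Near` is load-bearing**: without the matching hypothesis the empty configuration (vacuously
separated and force-balanced) would have to be a two-lattice, but `Sites t' A' ∋ t' 0`. Witness:
`X = ∅`, `δ = 1`, `A = 0.97·id`, `t = (0, A(w + √(2/3)e₃))`. [folklore] -/
theorem core_false_without_Near : ¬ CoreWithoutNear := by
  intro h
  let A : E3 →L[ℝ] E3 := (97 / 100 : ℝ) • ContinuousLinearMap.id ℝ E3
  have hAdm : Adm A := by
    refine ⟨LinearIsometryEquiv.refl ℝ E3, ?_⟩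
    have h0 : A - (97 / 100 : ℝ) •
        ((LinearIsometryEquiv.refl ℝ E3).toContinuousLinearEquiv : E3 →L[ℝ] E3) = 0 := by
      apply ContinuousLinearMap.ext
      intro x
      simp [A]
    rw [h0, norm_zero]
    norm_num
  let t : Fin 2 → E3 := ![0, A (barlowOffset 1 + layerNormal (Real.sqrt (2 / 3)))]
  have hInner : Inner t A := by
    simp only [Inner, t, Matrix.cons_val_one, Matrix.cons_val_zero, Matrix.cons_val_fin_one,
      sub_zero, sub_self, norm_zero]
    norm_num
  obtain ⟨t', A', -, hX⟩ :=
    h 1 one_pos ∅ (by simp [Sep]) (by simp [Equil]) t A hAdm hInner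
  have hmem : t' 0 + A' 0 ∈ Sites t' A' := ⟨0, 0, zero_mem_Lam, rfl⟩
  rw [← hX] at hmem
  exact hmem

/-- `Core` with the admissibility hypothesis `Adm A` on the REFERENCE cell dropped (the conclusion
still asks for an admissible `A'`). -/
def CoreWithoutAdm : Prop :=
  ∀ δ : ℝ, 0 < δ → ∀ X : Set E3, Sep X δ → Equil X →
    ∀ (t : Fin 2 → E3) (A : E3 →L[ℝ] E3), Inner t A →
      (∀ (c : E3) (r : ℝ), Near X c r t A (1 / 40)) →
        ∃ (t' : Fin 2 → E3) (A' : E3 →L[ℝ] E3), Adm A' ∧ X = Sites t' A'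

/-- **`Adm A` is load-bearing**: with the degenerate cell `A = 0` and `t = (0, 0)` the reference
"two-lattice" collapses to the single site `0`; the one-particle configuration `X = {0}` is separated,
force-balanced (empty force sum) and globally matched to it, but it is not `Sites t' A'` for an
admissible `A'`: that set contains `t' 0` and `t' 0 + A'(2√(2/3)e₃)`, which differ because
`‖A' z‖ ≥ (0.97 − 1/40)‖z‖`. [folklore] -/
theorem core_false_without_Adm : ¬ CoreWithoutAdm := by
  intro h
  have hInner : Inner (fun _ => (0 : E3)) 0 := by
    norm_num [Inner]
  have hSep : Sep {(0 : E3)} 1 := by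
    intro p hp q hq hne
    rw [Set.mem_singleton_iff] at hp hq
    exact (hne (hp.trans hq.symm)).elim
  have hEquil : Equil {(0 : E3)} := by
    intro p hp
    rw [Set.mem_singleton_iff] at hp
    haveI : IsEmpty {q : E3 // q ∈ ({0} : Set E3) ∧ q ≠ p} :=
      ⟨fun q => q.2.2 ((Set.mem_singleton_iff.mp q.2.1).trans hp.symm)⟩
    exact hasSum_empty
  have hNear : ∀ (c : E3) (r : ℝ), Near {(0 : E3)} c r (fun _ => 0) 0 (1 / 40) := by
    intro c r
    constructor
    · intro p hp _
      rw [Set.mem_singleton_iff] at hp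
      refine ⟨0, 0, zero_mem_Lam, ?_⟩
      simp [hp]
    · intro m z _ _
      refine ⟨0, rfl, ?_⟩
      simp
  obtain ⟨t', A', ⟨R, hR⟩, hX⟩ := h 1 one_pos {0} hSep hEquil _ 0 hInner hNear
  set cv : E3 := layerNormal (2 * Real.sqrt (2 / 3)) with hcv
  have h0 : t' 0 ∈ ({0} : Set E3) := by
    rw [hX]; exact ⟨0, 0, zero_mem_Lam, by simp⟩
  have h1 : t' 0 + A' cv ∈ ({0} : Set E3) := by
    rw [hX]; exact ⟨0, cv, layerNormal_mem_Lam, rfl⟩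
  rw [Set.mem_singleton_iff] at h0 h1
  rw [h0, zero_add] at h1
  have hpos : 0 < ‖cv‖ := norm_pos_iff.mpr layerNormal_ne_zero
  have key : ‖(A' - (97 / 100 : ℝ) • (R.toContinuousLinearEquiv : E3 →L[ℝ] E3)) cv‖ ≤
      1 / 40 * ‖cv‖ :=
    (ContinuousLinearMap.le_opNorm _ _).trans (mul_le_mul_of_nonneg_right hR (norm_nonneg _))
  have heq : ‖(A' - (97 / 100 : ℝ) • (R.toContinuousLinearEquiv : E3 →L[ℝ] E3)) cv‖ =
      97 / 100 * ‖cv‖ := by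
    simp [h1, norm_smul]
  rw [heq] at key
  nlinarith

/-- `Core` with the force-balance hypothesis `Equil X` dropped. -/
def CoreWithoutEquil : Prop :=
  ∀ δ : ℝ, 0 < δ → ∀ X : Set E3, Sep X δ →
    ∀ (t : Fin 2 → E3) (A : E3 →L[ℝ] E3), Adm A → Inner t A →
      (∀ (c : E3) (r : ℝ), Near X c r t A (1 / 40)) →
        ∃ (t' : Fin 2 → E3) (A' : E3 →L[ℝ] E3), Adm A' ∧ X = Sites t' A'

/-- **`Equil` is load-bearing**: without force balance, hcp plus ONE interstitial-like extra particle
`p₀ = (0, 0, 1/40)` next to the site `0` (`X = hcpStacking 0.97 (0.97√(2/3)) ∪ {p₀}`) is `1/40`-separated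
and globally two-way `1/40`-matched with the exact hcp datum, but is not a two-lattice `Sites t' A'` with
`A'` admissible: if `0` and `p₀` lay in the same coset, `p₀ ∈ A'(Λ ∖ 0)` would have norm `≥ 0.945`; if in
different cosets, `X` would contain `q₁ + p₀` or `q₁ − p₀` for the site `q₁ = (0.97, 0, 0)`, whose third
coordinate `±1/40` is not a layer height `K · 0.79`. (Physically: the pair `0, p₀` at distance `1/40`
repels with force `≈ 40¹³`, so `Equil` is exactly what excludes it.) [folklore] -/
theorem core_false_without_Equil : ¬ CoreWithoutEquil := by
  intro h
  -- the reference datum: isotropic cell 0.97, exact hcp translations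
  set a : ℝ := 97 / 100 with ha_def
  have ha0 : (0 : ℝ) ≤ a := by norm_num [ha_def]
  set hh : ℝ := a * Real.sqrt (2 / 3) with hh_def
  have hs : (1 / 2 : ℝ) < Real.sqrt (2 / 3) := by
    rw [show (1 / 2 : ℝ) = Real.sqrt (1 / 4) by
      rw [show (1 / 4 : ℝ) = (1 / 2) ^ 2 by norm_num, Real.sqrt_sq (by norm_num)]]
    exact Real.sqrt_lt_sqrt (by norm_num) (by norm_num)
  have hh1 : (1 / 20 : ℝ) < hh := by rw [hh_def, ha_def]; nlinarith
  have hh0 : (0 : ℝ) ≤ hh := by linarith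
  have hmin : (1 / 20 : ℝ) ≤ min a hh := le_min (by norm_num [ha_def]) hh1.le
  let A : E3 →L[ℝ] E3 := a • ContinuousLinearMap.id ℝ E3
  let t : Fin 2 → E3 := ![0, a • (barlowOffset 1 + layerNormal (Real.sqrt (2 / 3)))]
  have hSites : Sites t A = hcpStacking a hh := sites_eq_hcpStacking a
  have hAdm : Adm A := by
    refine ⟨LinearIsometryEquiv.refl ℝ E3, ?_⟩
    have h0 : A - (97 / 100 : ℝ) •
        ((LinearIsometryEquiv.refl ℝ E3).toContinuousLinearEquiv : E3 →L[ℝ] E3) = 0 := by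
      apply ContinuousLinearMap.ext
      intro x
      simp [A, ha_def]
    rw [h0, norm_zero]
    norm_num
  have hInner : Inner t A := by
    simp only [Inner, t, A, Matrix.cons_val_one, Matrix.cons_val_zero, Matrix.cons_val_fin_one,
      sub_zero, FunLike.coe_smul, Pi.smul_apply, ContinuousLinearMap.id_apply, sub_self,
      norm_zero]
    norm_num
  -- the extra particle and the configuration
  let p₀ : E3 := layerNormal (1 / 40)
  have hp₀ : ‖p₀‖ = 1 / 40 := by
    rw [EuclideanSpace.norm_eq, Fin.sum_univ_three]
    simp [p₀, layerNormal]
  let X : Set E3 := hcpStacking a hh ∪ {p₀}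
  have h0hcp : (0 : E3) ∈ hcpStacking a hh := by
    have : barlowPos a hh alternatingHagg 0 0 0 = 0 := by
      ext l; fin_cases l <;> simp
    exact this ▸ barlowPos_mem 0 0 0
  -- hypotheses of Core for the witness
  have hSep : Sep X (1 / 40) := by
    have key : ∀ q ∈ hcpStacking a hh, 1 / 40 ≤ dist q p₀ := by
      intro q hq
      by_cases hq0 : q = 0
      · subst hq0; rw [dist_comm, dist_zero_right, hp₀]
      · have h1 : min a hh ≤ dist q 0 := le_dist_of_mem_barlowStacking a hh alternatingHagg ha0 hh0 hq h0hcp hq0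
        have h2 : dist q 0 ≤ dist q p₀ + dist p₀ 0 := dist_triangle _ _ _
        rw [dist_zero_right p₀, hp₀] at h2
        linarith
    rintro p (hp | hp) q (hq | hq) hne
    · exact le_trans (by linarith) (le_dist_of_mem_barlowStacking a hh alternatingHagg ha0 hh0 hp hq hne)
    · rw [Set.mem_singleton_iff] at hq; subst hq; exact key p hp
    · rw [Set.mem_singleton_iff] at hp; subst hp; rw [dist_comm]; exact key q hq
    · rw [Set.mem_singleton_iff] at hp hq; exact (hne (hp.trans hq.symm)).elim
  have hNear : ∀ (c : E3) (r : ℝ), Near X c r t A (1 / 40) := by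
    intro c r
    constructor
    · rintro p (hp | hp) -
      · rw [← hSites] at hp
        obtain ⟨m, z, hz, rfl⟩ := hp
        exact ⟨m, z, hz, by simp⟩
      · rw [Set.mem_singleton_iff] at hp
        subst hp
        refine ⟨0, 0, zero_mem_Lam, ?_⟩
        simp [t, dist_eq_norm, hp₀]
    · intro m z hz _
      refine ⟨t m + A z, ?_, by simp⟩
      left
      rw [← hSites]
      exact ⟨m, z, hz, rfl⟩
  obtain ⟨t', A', hA', hX⟩ := h (1 / 40) (by norm_num) X hSep t A hAdm hInner hNear
  have hlow := adm_norm_le hA'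
  -- three particles of X as points of the concluded two-lattice
  set q₁ : E3 := barlowPos a hh alternatingHagg 0 1 0 with hq₁_def
  have hq₁0 : q₁ 0 = a := by rw [hq₁_def, barlowPos_apply_zero]; simp
  have hq₁2 : q₁ 2 = 0 := by rw [hq₁_def, barlowPos_apply_two]; simp
  have h0X : (0 : E3) ∈ Sites t' A' := hX ▸ (Or.inl h0hcp : (0 : E3) ∈ X)
  have hpX : p₀ ∈ Sites t' A' := hX ▸ (Or.inr rfl : p₀ ∈ X)
  have hqX : q₁ ∈ Sites t' A' := hX ▸ (Or.inl (barlowPos_mem 0 1 0) : q₁ ∈ X)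
  obtain ⟨m₀, z₀, hz₀, e₀⟩ := h0X
  obtain ⟨m₁, z₁, hz₁, e₁⟩ := hpX
  obtain ⟨m₂, z₂, hz₂, e₂⟩ := hqX
  -- no point of X has third coordinate ±1/40 and first coordinate a
  have notin : ∀ s : ℝ, (s = 1 ∨ s = -1) → q₁ + s • p₀ ∉ X := by
    rintro s hs (hmem | hmem)
    · obtain ⟨K, i, j, hK⟩ := hmem
      have e2 := congrArg (fun v : E3 => v 2) hK
      simp only [PiLp.add_apply, PiLp.smul_apply, hq₁2, barlowPos_apply_two, smul_eq_mul] at e2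
      have hp2 : p₀ 2 = 1 / 40 := by simp [p₀, layerNormal]
      rw [hp2] at e2
      -- e2 : 0 + s * (1/40) = K * hh
      rcases lt_trichotomy K 0 with hK0 | rfl | hK0
      · have : (K : ℝ) ≤ -1 := by exact_mod_cast Int.le_sub_one_iff.mpr hK0
        rcases hs with rfl | rfl <;> nlinarith
      · rcases hs with rfl | rfl <;> norm_num at e2
      · have : (1 : ℝ) ≤ K := by exact_mod_cast hK0
        rcases hs with rfl | rfl <;> nlinarith
    · rw [Set.mem_singleton_iff] at hmem
      have e0 := congrArg (fun v : E3 => v 0) hmem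
      simp only [PiLp.add_apply, PiLp.smul_apply, hq₁0, smul_eq_mul] at e0
      have hp0 : p₀ 0 = 0 := by simp [p₀, layerNormal]
      rw [hp0] at e0
      norm_num [ha_def] at e0
  by_cases hm : m₀ = m₁
  · -- same coset: p₀ = A'(z₁ - z₀) is too short
    subst hm
    have hdiff : p₀ = A' (z₁ - z₀) := by
      rw [map_sub]
      have := congrArg₂ (· - ·) e₁ e₀
      simpa using this
    have hne : z₁ - z₀ ≠ 0 := by
      intro hz
      rw [hz, map_zero] at hdiff
      have : ‖p₀‖ = 0 := by rw [hdiff, norm_zero]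
      rw [hp₀] at this
      norm_num at this
    have h1 := one_le_norm_of_mem_Lam (sub_mem_Lam hz₁ hz₀) hne
    have h2 := hlow (z₁ - z₀)
    rw [← hdiff, hp₀] at h2
    linarith
  · -- different cosets: X would be invariant under the short translation p₀ on one coset
    have hm₂ : m₂ = m₀ ∨ m₂ = m₁ := by
      fin_cases m₀ <;> fin_cases m₁ <;> fin_cases m₂ <;> simp_all
    rcases hm₂ with rfl | rfl
    · -- q₁ + p₀ = t' m₁ + A' (z₂ + z₁ - z₀) ∈ X
      apply notin 1 (Or.inl rfl)
      rw [one_smul, hX]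
      refine ⟨m₁, z₂ + (z₁ - z₀), add_mem_Lam hz₂ (sub_mem_Lam hz₁ hz₀), ?_⟩
      have e : t' m₁ = p₀ - A' z₁ := eq_sub_of_add_eq e₁.symm
      rw [e, e₂, map_add, map_sub]
      have e' : t' m₂ = -A' z₀ := by
        have := e₀; exact eq_neg_of_add_eq_zero_left this.symm
      rw [e']
      abel
    · -- q₁ - p₀ = t' m₀ + A' (z₂ - z₁ + z₀) ∈ X
      apply notin (-1) (Or.inr rfl)
      rw [neg_one_smul, hX]
      refine ⟨m₀, z₂ - (z₁ - z₀), sub_mem_Lam hz₂ (sub_mem_Lam hz₁ hz₀), ?_⟩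
      have e : t' m₀ = -A' z₀ := eq_neg_of_add_eq_zero_left e₀.symm
      have e' : t' m₂ = p₀ - A' z₁ := eq_sub_of_add_eq e₁.symm
      rw [e, e₂, e', map_sub, map_sub]
      abel

end LoadBearing


/-! ## Landscape facts behind "why it resists" (checked) -/
section Landscape

open Literature.Barriers.AtomisticToContinuum (lennardJonesWith lennardJones_eq_lennardJonesWith
  iter_deriv_two_lennardJonesWith)

/-- `V_LJ'(r) = −r⁻¹³ + r⁻⁷` for `r ≠ 0` (the pair force entering `Equil`). [cite: BlancLewin2015, §1.1 (3)] -/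
theorem hasDerivAt_lennardJones {r : ℝ} (hr : r ≠ 0) :
    HasDerivAt lennardJones (-(r⁻¹ ^ 13) + r⁻¹ ^ 7) r := by
  have h1 : HasDerivAt (fun s : ℝ => s⁻¹) (-(r⁻¹ ^ 2)) r := by
    simpa [inv_pow] using hasDerivAt_inv hr
  have h := ((h1.fun_pow 12).const_mul (1 / 12 : ℝ)).fun_sub ((h1.fun_pow 6).const_mul (1 / 6 : ℝ))
  have hf : lennardJones = fun s : ℝ => 1 / 12 * s⁻¹ ^ 12 - 1 / 6 * s⁻¹ ^ 6 := by
    funext s; simp [lennardJones]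
  rw [hf]
  refine h.congr_deriv ?_
  push_cast
  ring

/-- `deriv V_LJ r = −r⁻¹³ + r⁻⁷` for `r ≠ 0`. [cite: BlancLewin2015, §1.1 (3)] -/
theorem deriv_lennardJones {r : ℝ} (hr : r ≠ 0) : deriv lennardJones r = -(r⁻¹ ^ 13) + r⁻¹ ^ 7 :=
  (hasDerivAt_lennardJones hr).deriv

/-- `V_LJ''(r) = 13 r⁻¹⁴ − 7 r⁻⁸` for `r ≠ 0` (the bond stiffness entering `Hess`/`PS`), from the tree's
`iter_deriv_two_lennardJonesWith`. [cite: BlancLewin2015, §1.1 (3)] -/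
theorem deriv_deriv_lennardJones {r : ℝ} (hr : r ≠ 0) :
    deriv (deriv lennardJones) r = 13 * r⁻¹ ^ 14 - 7 * r⁻¹ ^ 8 := by
  have h := iter_deriv_two_lennardJonesWith (1 / 12) (1 / 6) hr
  rw [← lennardJones_eq_lennardJonesWith] at h
  simp only [Function.iterate_succ, Function.iterate_zero, Function.comp_apply, id_eq] at h
  rw [h]
  ring

/-- **Compressed bonds are repulsive, stretched bonds attractive**: `V′(r) < 0` for `0 < r < 1`.
[cite: BlancLewin2015, §1.1 (3)] -/
theorem deriv_lennardJones_neg {r : ℝ} (hr0 : 0 < r) (hr1 : r < 1) : deriv lennardJones r < 0 := by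
  rw [deriv_lennardJones hr0.ne']
  have hinv : 1 < r⁻¹ := (one_lt_inv₀ hr0).mpr hr1
  have h6 : (1 : ℝ) < r⁻¹ ^ 6 := one_lt_pow₀ hinv (by norm_num)
  have h7 : (0 : ℝ) < r⁻¹ ^ 7 := by positivity
  have : r⁻¹ ^ 13 = r⁻¹ ^ 7 * r⁻¹ ^ 6 := by ring
  nlinarith

/-- **Strict convexity on the whole nearest-neighbour window.** `V″(r) > 0` for `0 < r ≤ 107/100`; under
the crux's hypotheses every nearest-neighbour PARTICLE distance lies in `[0.87, 1.07]` (site distances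
`[0.92, 1.02]`, each particle within `1/40` of its site), so every nearest-neighbour bond of a would-be
counterexample sits in the strictly convex region of `V` (inflection at `(13/7)^{1/6} ≈ 1.1087`). This is
the arithmetic behind the failure of the period-doubling / dimerisation kill at tolerance `1/40`. [folklore] -/
theorem deriv_deriv_lennardJones_pos {r : ℝ} (hr0 : 0 < r) (hr : r ≤ 107 / 100) :
    0 < deriv (deriv lennardJones) r := by
  rw [deriv_deriv_lennardJones hr0.ne']
  have h6 : r ^ 6 < 13 / 7 :=
    calc r ^ 6 ≤ (107 / 100 : ℝ) ^ 6 := by gcongr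
      _ < 13 / 7 := by norm_num
  have hinv : 0 < r⁻¹ := inv_pos.mpr hr0
  have hfac : 13 * r⁻¹ ^ 14 - 7 * r⁻¹ ^ 8 = r⁻¹ ^ 14 * (13 - 7 * r ^ 6) := by
    field_simp
  rw [hfac]
  exact mul_pos (pow_pos hinv 14) (by linarith)

/-- **The second shell is concave.** `V″(r) < 0` for `r ≥ 111/100`: second neighbours (`≈ √2 · 0.97 ≈
1.37`) and the `PS` cutoff `11/10 < (13/7)^{1/6} < 111/100` sit on opposite sides of the inflection point,
so no global convexity argument is available — the coarse basin `1/40 → ε₀` is genuinely nonlinear.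
[folklore] -/
theorem deriv_deriv_lennardJones_neg {r : ℝ} (hr : 111 / 100 ≤ r) :
    deriv (deriv lennardJones) r < 0 := by
  have hr0 : 0 < r := by linarith
  rw [deriv_deriv_lennardJones hr0.ne']
  have h6 : 13 / 7 < r ^ 6 :=
    calc (13 / 7 : ℝ) < (111 / 100 : ℝ) ^ 6 := by norm_num
      _ ≤ r ^ 6 := by gcongr
  have hinv : 0 < r⁻¹ := inv_pos.mpr hr0
  have hfac : 13 * r⁻¹ ^ 14 - 7 * r⁻¹ ^ 8 = r⁻¹ ^ 14 * (13 - 7 * r ^ 6) := by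
    field_simp
  rw [hfac]
  exact mul_neg_of_pos_of_neg (pow_pos hinv 14) (by linarith)

end Landscape

/-! ## Near-misses (paper proofs in the docstrings; `sorry` permitted in this work file only) -/
section NearMisses

/-- **`Sep` is redundant** (any proof may take `δ = 87/100` for free). Paper proof: let
`C_s := X ∩ B(s, 1/40)` for sites `s`; distinct sites are ≥ 0.92 apart (`Adm`, `Inner`, `|z| ≥ 1` on
`Λ ∖ 0`), so the `C_s` partition `X` (first half of `Near`) and points of different clusters are ≥ 0.87
apart. `Equil` at `p` forces `C_s` finite (else the force family is not summable: infinitely many terms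
of norm ≥ |V′(1/20)|). If some `|C_s| ≥ 2`, take `s` with `|C_s| = k` maximal and a diameter pair
`p, q*` of `C_s`, `n = (p − q*)/|p − q*|`; for `q ∈ C_s ∖ {p}`: `⟨p − q, n⟩ ≥ |p − q|²/(2D)` hence the
`n`-component of the repulsion from `q` is ≥ |V′(D)|/2 ≥ 20¹³/2 (D ≤ 1/20), total ≥ (k−1)·4·10¹⁶ outward,
while the other clusters contribute at most `k · Σ_{s'≠s} sup_{r ≥ |s−s'|−1/20} |V′(r)| < 10² k`:
contradiction. Hence `|C_s| ≤ 1`, the second half of `Near` gives `|C_s| = 1`, and `X` is 0.87-separated.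
Formalising needs explicit lattice-sum bounds for `Σ_{s'} |V′|` over the affine two-lattice. [folklore] -/
theorem sep_of_equil_of_near (X : Set E3) (t : Fin 2 → E3) (A : E3 →L[ℝ] E3)
    (hA : Adm A) (ht : Inner t A) (hE : Equil X) (hN : ∀ (c : E3) (r : ℝ), Near X c r t A (1 / 40)) :
    Sep X (87 / 100) := by
  sorry

/-- **Same cell**: under global `1/40`-matching the conclusion's lattice is forced, `A'Λ = AΛ`
(so `Core` really says: `X = Sites t' A` with `t'_m ≡ t_{σ m}` within `1/40` modulo `AΛ`). Paper proof
(determinant-free, all ingredients are lattice arithmetic of the kind landed in `EquilLoadBearing.lean`):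
(1) reference sites are `0.92`-separated (`hcpLiouvilleAdm_norm_le`, `hcpLiouvilleLam_one_le_norm`, and
`|d₀ + ζ|² = (2i+j+1)²/4 + (3j+1)²/12 + (2/3)(2k+1)² ≥ 1` for the B-coset), so every `p ∈ X` has a UNIQUE
matched site `s(p)` — only the first half of `Near` is used; (2) for `g ∈ Λ` and `p_n := t' 0 + A'(n g)`,
`δ_n := s(p_{n+1}) − s(p_n) ∈ {0, ±d} + AΛ` is within `1/20` of `A' g`; two such differ by an element of
`{0, ±d, ±2d} + AΛ` of norm `≤ 1/10`, and the nonzero ones have norm `≥ 0.49` (`2d₀ ≡ −w`, `|w + ζ| ≥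
1/√3`), so `δ_n ≡ δ`; boundedness of `n(A'g − δ)` gives `A' g = δ`; `δ ∈ ±d + AΛ` would put `2δ = A'(2g)`
in `±2d + AΛ`, forcing `d`, `2d` or `3d ∈ AΛ`, each excluded (`|d₀+ζ| ≥ 1`, `|2d₀+ζ| ≥ 0.57`, `|3d₀+ζ| ≥
0.81` against slack ≤ 3/40). Hence `A'Λ ⊆ AΛ`, i.e. `A' = A M` with `M Λ ⊆ Λ`; (3) `‖M − Q‖ ≤ 0.06` for the
isometry `Q = R⁻¹R'`, so `Mu, Mv` are vectors of `Λ` with norm² in `[0.88, 1.13]` — only the six in-plane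
unit vectors (norm form `i² + ij + j² + (8/3)k²`) — at mutual angle ≈ 60°, hence a basis of the layer
lattice, and `Mc` has norm² in `[2.3, 3.1]`: `±c` or an in-plane vector of norm² 3, the latter excluded by
`|⟨Mc, Mu⟩|, |⟨Mc, Mv⟩| ≤ 0.2 < 3/2`; so `MΛ = Λ`. No density or determinant argument is needed. [folklore] -/
theorem same_cell (X : Set E3) (t t' : Fin 2 → E3) (A A' : E3 →L[ℝ] E3)
    (hA : Adm A) (ht : Inner t A) (hA' : Adm A') (hX : X = Sites t' A')
    (hN : ∀ (c : E3) (r : ℝ), Near X c r t A (1 / 40)) :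
    A' '' Lam = A '' Lam := by
  sorry

end NearMisses


/-! ## Numerics (kit compute; scripts `ljsearch/main.py`, `ljsearch2/main.py` in the seat folder; evidence on the item)

All in the crux's normalisation `V = r⁻¹²/12 − r⁻⁶/6`. Job j008362 (smoke scale; 2026-08-16): self-tests
reproduce the printed lattice sums (`A₆ = 14.45490`, `A₁₂ = 12.13229`, `a* = 0.97123`, `e* = −0.717590`);
relaxed LJ hcp: `a = 0.971420`, `c/a = 1.632742` (ideal 1.632993), `e = −0.717581`.

**PhononStability (the hypothesis `PS`)** — `κ(A,t) := min_k λ_min` of the pencil `(D_A,t(k), S_A,t(k))`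
(`D` = Bloch force-constant 6×6 family of `Sites t A` with lattice sums to radius 5–7, `S` = the statement's
nearest-neighbour strain form with cutoff 11/10), i.e. the best constant in the inequality of `PS` restricted
to Bloch waves: relaxed 0.456 · `0.97·I` 0.466 · isotropic +1/40 (tension) 0.309 · −1/40 (compression) 0.702
· uniaxial/deviatoric/shear corners 0.364–0.536 · `0.97·I` with inner shift 1/40 (±x, ±y, ±z, xyz) 0.370–0.452
· tension + inner shifts 0.249–0.298 · compression + inner shifts 0.552–0.683 · xz-shear + inner shifts
0.199–0.351. `κ_min = 0.199` (k-grid 3³ + special points; dense 8³ grid + 24 random window points queued as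
j013940). No negative eigenvalue anywhere: the window is harmonically stable with a margin, so `HcpLiouville`
is a genuine (non-vacuous) conditional.

**Isolation radius of hcp among periodic LJ equilibria** — exhaustive symmetry-restricted scans (all fixed
subspaces of dim ≤ 6 of the supercell space group, grid multistart Newton, amplitude ≤ 0.15) and deflated
Newton / least-squares / min-mode searches in the 1×1×2 and 2×2×1 supercells of the relaxed cell and of the
tension corner found 35 distinct non-two-lattice critical points; sup-distance `d` to the nearest two-lattice
with the same Bravais lattice (free sublattice translations; the `Inner`-constrained distance is ≥ d):
  d = 0.0982 (relaxed, 2×2×1, index 1, ΔE/atom = 0.0344, min pair 0.932, found 14×) ·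
  d = 0.1047 (relaxed, 1×1×2, index 2, ΔE = 0.0254) · d = 0.1068 (tension, 1×1×2, index 2, ΔE = 0.0176) ·
  d = 0.1194 (relaxed, 2×2×1, index 0 — a competing periodic LOCAL MINIMUM, bcc-like/Burgers, ΔE = 0.0334,
  min pair 0.930) · d = 0.140, 0.144 (index 1) · then ≥ 0.176 (stacking-type and high-index points up to
  d = 0.47). Nothing at d ≤ 0.098; in particular nothing within 1/40 = 0.025.
  CONSEQUENCES: (a) no kill; (b) TIGHTNESS: the natural strengthening "tolerance 1/10 instead of 1/40" is
  numerically false (the index-1 saddle at 0.098 and the bcc-like minimum at 0.119 are 0.93-separated periodic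
  equilibria, hence globally matched at that tolerance with the relaxed — admissible — cell; whether the
  matching datum can be chosen `Inner` is being checked, j013923); (c) the planners' "one repair = halve the
  tolerance" rule is not triggered, but the safety factor of 1/40 is ≈ 4, not the ≈ 10 suggested by the
  bcc/stacking estimates in the route file — the nearest competitor is a SADDLE, invisible to energy
  minimisation ("CHEAPEST FALSIFIER (b)" of the route relaxes forces by minimisation and cannot see it).
  Larger supercells (1×1×3, 1×1×4, 3×3×1, 2×2×2, 3×3×2, 4×4×2) and the other window corners: jobs
  j013934/j013935/j013939/j013940 queued; this section is updated when they return.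
-/

end Summit.AtomisticToContinuum.Crystallization.Cruxes.HcpLiouville.Disproof
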